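import Summits.CriticalPhenomena.PercolationContinuityZ3.Theorems.PercNearOneGluingNoHeavyQuantSingleMidTerms
import Summits.CriticalPhenomena.PercolationContinuityZ3.Theorems.PercNearOneGluingNoHeavyQuantMidPriceCriterion
import HarnessLib

/-!
# QUANT lane R8, T-DEC: THE TWO-MID CRITERION FOR A LAW GIVEN BY TERMS (`LawDec.decAtT_of_twoMid_terms`) — the cell interface of the
# crossed Type II class of `LightSliceLowCrossBelow` (two useful mids `p + h′ < p + h`; census-2 g60)

builds on p205010 (kernel theorem, internal audit signed; external expert review pending)

Support file (`--supports stmt-CriticalPhenomena-4575`), QUANT lane seat prim-quant-census-2 (gen 60), rung R8 of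
`run/shared/lean/prim/quant/LADDER.md`.  Memo `run/shared/lean/prim/quant/prim-quant-census-2-g60/TWO-MID-G60.md`.  Theorems only,
standard axioms, no sorries, no definitions.

WHY.  In `LightSliceLowCrossBelow` (census-2 g59, p333141) the crossed Type II pairs (`h₂′ < h₂`, `l₁′ + h₂ ≤ j`) give a light slice — an
EIGHT-TERM law (`lightSlice_eq_terms`) — with four conv-lows, TWO useful mids (the head cell `p + h′` AND the lower cross cell `p + h` of the
expensive piece, now below the giant line) and the giant pool.  Census-2 g59's `decAtT_of_midPrices` is the normalised dual for any number of
mids, stated for a law as a function of the position; this file restates its two-mid instance for a law given by TERMS (coinciding positions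
allowed), exactly as `decAtT_of_singleMid_terms` did for one mid:
* **`LawDec.decAtT_of_twoMid_terms`** — floor `0 < x < 1`, target `T`, layer `j`, top `M`; a law `Σ_i c_i δ_{pos_i}` (`c_i ≥ 0`, `Σ c_i = 1`,
  `pos_i ≤ M`); two mids `h₁ ≠ h₂` (`h ≤ j`, `h ≤ M`, `¬ 2h < T`).  If for all prices `β₁, β₂ ≥ 0`
  `Σ_{low terms} c_i · min(1, (T < pos_i + h₁ ? usage(pos_i,h₁)·β₁ : 1), (T < pos_i + h₂ ? usage(pos_i,h₂)·β₂ : 1))`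
  `≤ β₁·(mass at h₁) + β₂·(mass at h₂) + ((1−x)/x)·(giant mass)`, then the law is `DECAtT x T j M`.
(The cell prover evaluates the finitely many `if`s; every further mid is simply not used as an absorber.)

[this work]; LP duality [cite: Schrijver1986, Cor 7.1f (p. 90)] via `…QuantLawDecStrongDuality`.  The gluing rows served
[cite: KozmaNitzan2024, Conjecture 3 (p. 15)]; product measure [cite: Grimmett1999, §1.3 p. 10].
-/

noncomputable section

namespace Summit.CriticalPhenomena.PercolationContinuityZ3.Theorems

namespace Quant

open Finset

namespace LawDec

variable {ι : Type} [Fintype ι]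

/-- **THE TWO-MID CRITERION FOR A LAW GIVEN BY TERMS.**  See the module docstring. [this work] -/
theorem decAtT_of_twoMid_terms (x T : ℝ) (j M h₁ h₂ : ℕ) (c : ι → ℝ) (pos : ι → ℕ) (hx0 : 0 < x) (hx1 : x < 1)
    (hc0 : ∀ i, 0 ≤ c i) (hc1 : ∑ i, c i = 1) (hpos : ∀ i, pos i ≤ M)
    (hh₁j : h₁ ≤ j) (hh₁M : h₁ ≤ M) (hh₁T : ¬ (2 * (h₁ : ℝ) < T))
    (hh₂j : h₂ ≤ j) (hh₂M : h₂ ≤ M) (hh₂T : ¬ (2 * (h₂ : ℝ) < T)) (hne : h₁ ≠ h₂)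
    (hdual : ∀ β₁ β₂ : ℝ, 0 ≤ β₁ → 0 ≤ β₂ →
      ∑ i, (if pos i ≤ j ∧ 2 * (pos i : ℝ) < T then
          c i * min 1 (min (if T < (pos i : ℝ) + h₁ then usage x T j (pos i) h₁ * β₁ else 1)
                           (if T < (pos i : ℝ) + h₂ then usage x T j (pos i) h₂ * β₂ else 1)) else 0)
        ≤ β₁ * (∑ i, (if pos i = h₁ then c i else 0)) + β₂ * (∑ i, (if pos i = h₂ then c i else 0))
          + ((1 - x) / x) * ∑ i, (if j + 1 ≤ pos i then c i else 0)) :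
    DECAtT x T j M (fun q => ∑ i, c i * (if q = pos i then (1 : ℝ) else 0)) := by
  classical
  set μ : ℕ → ℝ := fun q => ∑ i, c i * (if q = pos i then (1 : ℝ) else 0) with hμ
  have hμ0 : ∀ q, 0 ≤ μ q := fun q => Finset.sum_nonneg fun i _ => mul_nonneg (hc0 i) (by split_ifs <;> norm_num)
  have hμM : ∀ q, M < q → μ q = 0 := by
    intro q hq
    refine Finset.sum_eq_zero fun i _ => ?_
    rw [if_neg (by have := hpos i; omega), mul_zero]
  have hμ1 : ∑ q ∈ Finset.range (M + 1), μ q = 1 := by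
    have := sum_range_mul_terms (M + 1) c pos (fun _ => (1 : ℝ))
    simp only [one_mul, mul_one] at this
    rw [this, ← hc1]
    refine Finset.sum_congr rfl fun i _ => ?_
    rw [if_pos (by have := hpos i; omega)]
  have hG : ∑ q ∈ Finset.Ico (j + 1) (M + 1), μ q = ∑ i, (if j + 1 ≤ pos i then c i else 0) := by
    rw [sum_Ico_terms (j + 1) (M + 1) c pos]
    refine Finset.sum_congr rfl fun i _ => ?_
    by_cases h1 : j + 1 ≤ pos i
    · rw [if_pos ⟨h1, by have := hpos i; omega⟩, if_pos h1]
    · rw [if_neg (by push Not; intro h; exact absurd h h1), if_neg h1]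
  have hmid : ∀ h₀, μ h₀ = ∑ i, (if pos i = h₀ then c i else 0) := by
    intro h₀
    refine Finset.sum_congr rfl fun i _ => ?_
    by_cases h1 : pos i = h₀
    · rw [if_pos h1.symm, if_pos h1, mul_one]
    · rw [if_neg (Ne.symm h1), if_neg h1, mul_zero]
  refine decAtT_of_midPrices x T j M μ hx0 hx1 hμ0 hμM hμ1 fun α β hβ hα1 hαU => ?_
  -- the left-hand side as a sum over the terms
  have eL : ∑ l ∈ Finset.range (j + 1), (if 2 * (l : ℝ) < T then α l * μ l else 0)
      = ∑ l ∈ Finset.range (j + 1), (if 2 * (l : ℝ) < T then α l else 0) * μ l := by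
    refine Finset.sum_congr rfl fun l _ => ?_
    split_ifs <;> simp
  rw [eL, sum_range_mul_terms (j + 1) c pos, hG]
  -- bound each low term by the min of its prices
  have hterm : ∀ i, (if pos i < j + 1 then c i * (if 2 * (pos i : ℝ) < T then α (pos i) else 0) else 0)
      ≤ (if pos i ≤ j ∧ 2 * (pos i : ℝ) < T then
          c i * min 1 (min (if T < (pos i : ℝ) + h₁ then usage x T j (pos i) h₁ * β h₁ else 1)
                           (if T < (pos i : ℝ) + h₂ then usage x T j (pos i) h₂ * β h₂ else 1)) else 0) := by
    intro i
    by_cases hl : pos i ≤ j ∧ 2 * (pos i : ℝ) < T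
    · rw [if_pos (by omega), if_pos hl.2, if_pos hl]
      refine mul_le_mul_of_nonneg_left ?_ (hc0 i)
      refine le_min (hα1 (pos i) hl.1 hl.2) (le_min ?_ ?_)
      · split_ifs with hc
        · exact hαU (pos i) h₁ hl.1 hl.2 hh₁j hh₁M hh₁T hc
        · exact hα1 (pos i) hl.1 hl.2
      · split_ifs with hc
        · exact hαU (pos i) h₂ hl.1 hl.2 hh₂j hh₂M hh₂T hc
        · exact hα1 (pos i) hl.1 hl.2
    · by_cases hl1 : pos i < j + 1
      · rw [if_pos hl1, if_neg (fun h2 => hl ⟨by omega, h2⟩), mul_zero, if_neg hl]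
      · rw [if_neg hl1, if_neg hl]
  have key := hdual (β h₁) (β h₂) (hβ h₁) (hβ h₂)
  -- the two mid terms are part of the right-hand side
  have hRHS : β h₁ * μ h₁ + β h₂ * μ h₂ ≤ ∑ h ∈ Finset.range (j + 1), (if 2 * (h : ℝ) < T then 0 else β h * μ h) := by
    have hsub : ({h₁, h₂} : Finset ℕ) ⊆ Finset.range (j + 1) := by
      intro k hk
      rw [Finset.mem_insert, Finset.mem_singleton] at hk
      rw [Finset.mem_range]
      rcases hk with rfl | rfl <;> omega
    have hnn : ∀ k ∈ Finset.range (j + 1), k ∉ ({h₁, h₂} : Finset ℕ) → 0 ≤ (if 2 * (k : ℝ) < T then 0 else β k * μ k) := by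
      intro k _ _
      split_ifs
      · exact le_rfl
      · exact mul_nonneg (hβ k) (hμ0 k)
    refine le_trans (le_of_eq ?_) (Finset.sum_le_sum_of_subset_of_nonneg hsub hnn)
    rw [Finset.sum_pair hne, if_neg hh₁T, if_neg hh₂T]
  calc ∑ i, (if pos i < j + 1 then c i * (if 2 * (pos i : ℝ) < T then α (pos i) else 0) else 0)
      ≤ ∑ i, (if pos i ≤ j ∧ 2 * (pos i : ℝ) < T then
          c i * min 1 (min (if T < (pos i : ℝ) + h₁ then usage x T j (pos i) h₁ * β h₁ else 1)
                           (if T < (pos i : ℝ) + h₂ then usage x T j (pos i) h₂ * β h₂ else 1)) else 0) :=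
        Finset.sum_le_sum fun i _ => hterm i
    _ ≤ β h₁ * (∑ i, (if pos i = h₁ then c i else 0)) + β h₂ * (∑ i, (if pos i = h₂ then c i else 0))
          + ((1 - x) / x) * ∑ i, (if j + 1 ≤ pos i then c i else 0) := key
    _ = β h₁ * μ h₁ + β h₂ * μ h₂ + ((1 - x) / x) * ∑ i, (if j + 1 ≤ pos i then c i else 0) := by
        rw [← hmid h₁, ← hmid h₂]
    _ ≤ _ := by linarith [hRHS]

end LawDec

end Quant

end Summit.CriticalPhenomena.PercolationContinuityZ3.Theorems
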